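import Literature.AlgebraicGeometry.ModuliOfAbelianVarieties.SiegelModuliComplexUniformisation
import Literature.Geometry.ComplexAnalytic.RelativeExponentialUniformisation
import Literature.AlgebraicGeometry.AbelianSchemes.PolarizedAbelianSchemeWithLevelBaseChange
import HarnessLib

/-!
# (P-3 «UNIV-FAMILY») The complex-analytic uniformisation of the universal family over the Siegel fine moduli scheme,
# and of its pull-backs, by relative exponential charts with the TAUTOLOGICAL period family
# — COMPOSITE PRINTED ROW ([Lange2023AbelianVarietiesComplex] Prop. 3.4.1 + Lemma 3.4.7 + Prop. 3.4.8 + Ex. 3.4.5 (7); [BirkenhakeLange2004] §8.7–§8.8;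
# [MumfordFogartyKirwan1994] App. to Ch. 7 §A; [SGA1] Exp. XII 1.2)

Layer `Literature/AlgebraicGeometry/ModuliOfAbelianVarieties`, namespace `Literature.AlgebraicGeometry.ModuliOfAbelianVarieties`.
ONE NAMED FACT (`def … : Prop`, D-0014; NO proof, NO `sorry`, no instance, no notation).  Cell `hodgecm-mathlib` (D-0151), FLOOR 0, P6 «MOD»
(crux hLiu418 = stmt-HodgeConjecture-24832, `--supports`).  LEAD F0P6-plan (g2) RULING «M-17m⁗» (2026-09-01T22:23:42Z): the organ U6-c of the
E-line `Cruxes/HLiu418/Lines/F0_P6a_PELWitnessE.lean` («door (E)», repair (I-1)) is THIS printed letter «P-3 UNIV-FAMILY», consumed in the E-line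
as `theorem stub_UNIVFAM : siegelUniversalFamilyUniformisation := by sorry` and by the `stub_E6` closure IN-LINE; typed by the E6 owner A-p06 (g32).
In T-VALUED (pulled-back) form, so that the E6 closure instantiates it ONCE at the record curve `T := X_ℂ` and neither the general relative
exponential fact (★ P-1 `relativeExponentialUniformisation`, which then leaves the cone) nor a chart-comparison organ is needed (A-p06 (α)-answer,
22:26:19Z).  HC_CM is proved only modulo the printed citations until rung 0 closes; in the books this def is ONE printed row inside the MOD cone
(director's pricing), discharge path = the Kuga ∕ quotient-manifold infrastructure the tree does not have (★ `Abdulali1994/…` :77).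

COMPOSITE PRINTED ROW (named fact P-3 «UNIV-FAMILY», M-17m⁗; LEAD ruling «P-3 LETTER WORDS» 22:41:36Z, lit1 (g3) P6L-080): the analytified
algebraic pull-back `P_T = 𝓜.univ ×_𝓜 T` identified with the tautological torus family — composite of [Lange2023AbelianVarietiesComplex] Prop. 3.4.1
+ Lemma 3.4.7 + Prop. 3.4.8 + Ex. 3.4.5 (7) applied to `(𝓜.univ_ℂ)^an` over an evenly covered `W`, ★ (U3-D3) pinning the classifying map, and [SGA1]
Exp. XII 1.2 for the pull-back along `ψ`; FAITHFUL TO PRINT, NOT ONE PRINTED SENTENCE (in particular NOT «the printed statement = Prop. 3.4.1»).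
THE PRINTED INGREDIENTS.  [Lange2023AbelianVarietiesComplex] §3.4 «The Universal Family», Prop. 3.4.1 p. 186, Lemma 3.4.7 + Prop. 3.4.8 pp. 189–191,
Ex. 3.4.5 (7) p. 191 (universality); cf. Thm. 3.1.2 p. 163 (= [BirkenhakeLange2004] §8.7–§8.8 pp. 229–234, Lemma 8.7.1, Lemma 8.8.1; cf. §8.1
Prop. 8.1.2; [MumfordFogartyKirwan1994] App. to Ch. 7 §A pp. 234–235, analytic description of `𝒜_{g,δ} ⊗ ℂ` and `𝒜*_{g,1,n} ⊗ ℂ` as Siegel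
quotients): the group `ℤ^{2g} ⋊ Γ_δ(N)` acts freely and properly
discontinuously on `𝔥_g × ℂ^g` by `(Z, z) ↦ (M⟨Z⟩, ᵗ(CZ+D)⁻¹(z + Z m + Δ n))` and the quotient `𝔛 → Γ_δ(N)∖𝔥_g` IS the (analytification of the)
universal family of polarized abelian varieties of type `δ` with level-`N` structure: over a small open `W` of a piece `S_c(ℂ)`, evenly covered
by the uniformisation `unif_c : 𝔥_g → S_c(ℂ)` with a holomorphic local inverse `s`, the universal family is `(W × ℂ^g)∕Π_{s(w)}ℤ^{2g}`,
`Π_Z(x, y) = Z x + Δ y` (★ `siegelPeriodMap`), and its fibre over `w` is the MARKED torus `X_{s(w)} = ℂ^g∕(s(w), Δ)ℤ^{2g}` of [LangeBirkenhake1992]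
§8.1 Prop. 8.1.1 with its polarisation of type `δ` and its level structure — i.e. an ADMISSIBLE marking in the sense of the tree's (U3∃) (★
`IsAdmissibleAt`).  Together with [SGA1] Exp. XII (Raynaud) 1.2, LNM 224 pp. 314–315 (`Φ = (·)^an` commutes with finite projective limits ∕ fibre products)
the same holds for the
PULL-BACK `P_T := 𝓐_univ ×_{𝓜} T` of the universal triple along any morphism `ψ : T → S_c` from a smooth complex variety `T`, with the lift
`s̃ := s ∘ ψ^an`: this is the T-valued form typed here.

THE TYPED FORM (by value, ★ currency only).  For every `𝓜 : SiegelFineModuliScheme g N δ` (★ (F)), every piece datum `(Sc, ιc, unif)` satisfying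
the (U2+) and (U3) clauses of ★ `siegelModuli_complexUniformisation` (continuity, openness, surjectivity of `unif` on `𝔥_g`, the `Γ_δ(N)`-fibres of
`unif`, holomorphy in affine coordinates; fibre identification (U3∃) and classification (U3-D3) — so `(Sc, ιc, unif)` IS a uniformised piece), every
smooth separated `T` of finite type over `ℂ` of relative dimension `d` with `ψ : T ⟶ Sc`, the pulled-back
triple `P_T := 𝓜.univ.baseChange (ψ ≫ ιc ≫ pr)` (★ `PolarizedAbelianSchemeWithLevel.baseChange`), ANY analytifications `φT : MT → T(ℂ)`,
`φA : MA → (totalOver T P_T.A)(ℂ)` (★ `IsAnalytification`), and every open `U ⊆ MT` carrying a holomorphic lift `s̃ : MT → 𝔥_g` of `ψ^an` through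
`unif` (`unif (s̃ t) = ψ(φT t)` on `U`): THERE ARE a period family `Φ` EQUAL TO `t ↦ Π_{s̃ t}` on `U` and a map `ex : MT × ℂ^g → MA` with
(C) `IsRelExpChartOn (ℂ^d) (ℂ^{d+g}) (basePoint hT P_T.A φA) U Φ ex` (★ currency, p846942); (G) for `t ∈ U` an ADDITIVE ANALYTIFICATION
`φt : ComplexTorus (Φ t) → A_t(ℂ)` of the fibre reading `ex (t, ·)` in the total space (the (G)-clause of ★ P-1, verbatim shape); (ADM) for every
principal representative `r` of `c` (the (U3) binder block verbatim) and `t ∈ U`, a marking `m` of the fibre triple `P_T|_t` by `[J(s̃ t), r]` which is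
ADMISSIBLE (the three conjuncts of ★ `IsAdmissibleAt`: ample `Θ` with `λ̄ = Λ(𝒪(Θ))`, symplectic lift `Λ` of the level structure read through `r`)
with `m.γ = 1`, `m.Ψ = Π_{s̃ t}` and torus map EQUAL to the chart's fibre map `ex (t, ·)` read in the total space.
(The sheet law «charts for `s̃` and `M•s̃`, `M ∈ Γ_δ(N)`, differ by the `Γ`-action» is then a THEOREM — uniqueness of admissible markings,
[Milne2005ShimuraVarieties] §6 Thm. 6.11 p. 74 / Serre's lemma ★ `eq_id_of_pow_eq_one_of_forall_fibrePoints_of_isLocallyNoetherian` — not part of the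
letter.)

CONSUMERS.  E6 closure of `F0_P6a_PELWitnessE` (`T := X_ℂ` the record curve, `ψ :=` ★ E4/E5's slice morphism, `s̃ := Z a ∘ ṽ` through the record's
piece uniformisation): `y_b :=` the endomorphism whose analytic representation in the chart is the `ℂ`-linear avatar `Cb` of `Mρ a b` (★ U6-b
`MarkedFamilyHomCriterion`, ★ E6-lin), algebraic by GAGA ★ `arapura2012_cor_15_4_6_holds` on the (projective) total space, descended to `Fᵢ` by ★ B-γ,
ring law ∕ Rosati by ★ B-α, Kottwitz by ★ E6-K.

## References
* [Lange2023AbelianVarietiesComplex] H. Lange, *Abelian Varieties over the Complex Numbers*, Grundlehren Text Edition (2023), §3.4 «The Universal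
  Family»: Prop. 3.4.1 p. 186, Lemma 3.4.7 and Prop. 3.4.8 pp. 189–191, Exercise 3.4.5 (7) p. 191 (universality); cf. Thm. 3.1.2 p. 163.
* [BirkenhakeLange2004] C. Birkenhake, H. Lange, *Complex Abelian Varieties*, 2nd ed. (2004), §8.7–§8.8 pp. 229–234 (Lemma 8.7.1, Lemma 8.8.1);
  cf. §8.1 Prop. 8.1.2.
* [MumfordFogartyKirwan1994] D. Mumford, J. Fogarty, F. Kirwan, *Geometric Invariant Theory*, 3rd ed. (1994), Appendix to Ch. 7 §A pp. 234–235
  (analytic description of `𝒜_{g,δ} ⊗ ℂ` and `𝒜*_{g,1,n} ⊗ ℂ` as Siegel quotients).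
* [SGA1] A. Grothendieck, *Revêtements étales et groupe fondamental* (SGA 1), LNM 224, Exp. XII (M. Raynaud) 1.2 pp. 314–315 (the functor
  `Φ = (·)^an` commutes with finite projective limits ∕ fibre products).
* [LangeBirkenhake1992] H. Lange, Ch. Birkenhake, *Complex Abelian Varieties* (1992), §8.1 Prop. 8.1.1 (`X_Z = ℂ^g∕(Z, D)ℤ^{2g}`).
* [Milne2005ShimuraVarieties] J. S. Milne, *Introduction to Shimura Varieties* (2005), §6 Thm. 6.11 p. 74 (moduli interpretation of `Sh_K(ℂ)`).
-/

set_option autoImplicit false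

noncomputable section

open CategoryTheory CategoryTheory.Limits AlgebraicGeometry Matrix Topology
open scoped Manifold ContDiff Matrix.Norms.Elementwise
open Literature.AlgebraicGeometry.Motives (SchemeOver ComplexPoints AlgPoints specOver AbelianVariety CartierDivisor)
open Literature.AlgebraicGeometry.AbelianSchemes (PolarizedAbelianSchemeWithLevel AbelianSchemeOver)
open Literature.Geometry.Kaehler (ComplexTorus)
open Literature.Geometry.Kaehler.ComplexTorus (cover)
open Literature.Geometry.ComplexAnalytic (IsRelExpChartOn totalOver basePoint)
open Literature.NumberTheory.Transcendental (IsAnalytification)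
open Literature.NumberTheory.Automorphic (siegelUpperHalfSpace)
open Literature.NumberTheory.Adeles (latticeOfGL)

namespace Literature.AlgebraicGeometry.ModuliOfAbelianVarieties

open SiegelModuli (jOfSiegel)

/-- **(P-3 «UNIV-FAMILY») COMPOSITE PRINTED ROW (named fact, M-17m⁗): the analytified algebraic pull-back `P_T = 𝓜.univ ×_𝓜 T` identified
with the tautological torus family — composite of [Lange2023AbelianVarietiesComplex] Prop. 3.4.1 + Lemma 3.4.7 + Prop. 3.4.8 + Ex. 3.4.5 (7)
applied to `(𝓜.univ_ℂ)^an` over an evenly covered `W`, ★ (U3-D3) pinning the classifying map, and [SGA1] Exp. XII 1.2 for the pull-back along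
`ψ`; faithful to print, not one printed sentence** (= [BirkenhakeLange2004] §8.7–§8.8; [MumfordFogartyKirwan1994] App. to Ch. 7 §A) — NAMED FACT
(D-0014; NO proof): the pull-back `P_T` of the universal Siegel triple along a
morphism `ψ : T → S_c` from a smooth complex variety into a piece of `𝓜 ⊗ ℂ` is uniformised, over every open `U ⊆ T^an` carrying a holomorphic
lift `s̃` of `ψ^an` through `unif_c`, by a RELATIVE EXPONENTIAL CHART (★ `IsRelExpChartOn`) whose period family is the TAUTOLOGICAL one
`t ↦ Π_{s̃ t}` (★ `siegelPeriodMap`), whose fibre maps are additive analytifications of the fibres ((G), the shape of ★ P-1's clause), and which ARE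
admissible markings of the fibre triples by `[J(s̃ t), r]` for every principal representative `r` of `c` ((ADM), the conjuncts of ★ `IsAdmissibleAt`
with `γ = 1`, `Ψ = Π_{s̃ t}`, torus map = chart fibre map).  `T := S_c`, `ψ := 𝟙` is the universal family itself.  See the module docstring for
the printed sentences and the consumer (E6 of `F0_P6a_PELWitnessE`).
[cite: Lange2023AbelianVarietiesComplex, Prop. 3.4.1 p. 186 + Lemma 3.4.7 + Prop. 3.4.8 pp. 189–191 + Ex. 3.4.5 (7) p. 191 (universality); cf. Thm. 3.1.2 p. 163]
[cite: BirkenhakeLange2004, §8.7–§8.8 pp. 229–234 (Lemma 8.7.1, Lemma 8.8.1); cf. §8.1 Prop. 8.1.2]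
[cite: MumfordFogartyKirwan1994, App. to Ch. 7 §A pp. 234–235 (analytic description of 𝒜_{g,δ} ⊗ ℂ and 𝒜*_{g,1,n} ⊗ ℂ as Siegel quotients)]
[cite: SGA1, Exp. XII (Raynaud) 1.2, LNM 224 pp. 314–315 (Φ = (·)^an commutes with finite projective limits ∕ fibre products)]
[cite: LangeBirkenhake1992, §8.1 (Prop. 8.1.1)] [cite: Milne2005ShimuraVarieties, §6 Thm. 6.11 p. 74] -/
def siegelUniversalFamilyUniformisation : Prop :=
  ∀ (g N : ℕ) (δ : Fin g → ℕ) (_hg : 0 < g) (hδ : IsPolarizationType δ) (_hN : 3 ≤ N) (𝓜 : SiegelFineModuliScheme g N δ)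
    -- a piece of `𝓜 ⊗ ℂ` with its uniformisation, satisfying the (U2+) clauses of ★ `siegelModuli_complexUniformisation`
    (c : (ZMod N)ˣ) (Sc : SchemeOver ℂ) (ιc : Sc ⟶ (Motives.baseChange ℚ ℂ).obj 𝓜.M)
    (unif : Matrix (Fin g) (Fin g) ℂ → ComplexPoints Sc)
    (_ : ContinuousOn unif (siegelUpperHalfSpace g)) (_ : IsOpenMap ((siegelUpperHalfSpace g).restrict unif))
    (_ : Set.SurjOn unif (siegelUpperHalfSpace g) Set.univ)
    (_ : ∀ Z ∈ siegelUpperHalfSpace g, ∀ Z' ∈ siegelUpperHalfSpace g,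
      unif Z = unif Z' ↔ ∃ M ∈ siegelLevelGroup δ N, ∃ C : (Fin g → ℂ) ≃ₗ[ℂ] (Fin g → ℂ),
        ∀ v : Fin g ⊕ Fin g → ℝ, C (siegelPeriodMap δ Z v) = siegelPeriodMap δ Z' (intAct M v))
    (_ : ∀ (V : Sc.left.affineOpens) (f : Sc.left.presheaf.obj (Opposite.op (↑V : Sc.left.Opens))),
      DifferentiableOn ℂ (fun Z ↦ AlgPoints.evalOrZero (↑V : Sc.left.Opens) f (unif Z))
        (siegelUpperHalfSpace g ∩ unif ⁻¹' {P | P.pt ∈ (↑V : Sc.left.Opens)}))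
    -- the (U3) junction for this piece: fibre identification (U3∃) and classification (U3-D3) at every `Z ∈ 𝔥_g`
    (_ : ∀ (u : finAdeleQˣ) (r : gspFinAdelic δ),
      (∀ v, Valued.v ((u : finAdeleQ) v) = 1) →
      (u : finAdeleQ) - ((c : ZMod N).val : ℕ) ∈ levelIdeal N →
      r ∈ principalLevelSubgroup δ 1 →
      IsMultiplier (typeFormOver δ finAdeleQ) (r : GL (Fin g ⊕ Fin g) finAdeleQ) u →
      ((r : GL (Fin g ⊕ Fin g) finAdeleQ) : Matrix (Fin g ⊕ Fin g) (Fin g ⊕ Fin g) finAdeleQ) =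
        Matrix.fromBlocks 1 0 0 ((u : finAdeleQ) • (1 : Matrix (Fin g) (Fin g) finAdeleQ)) →
      ∀ (Z : Matrix (Fin g) (Fin g) ℂ) (hZ : Z ∈ siegelUpperHalfSpace g),
        haveI : IsLocallyNoetherian (specOver ℚ ℂ).left :=
          inferInstanceAs (IsLocallyNoetherian (Spec (CommRingCat.of ℂ)))
        (∃ (P' : PolarizedAbelianSchemeWithLevel g N δ (specOver ℚ ℂ).left)
            (G : P'.A.X.left ⟶ 𝓜.univ.A.X.left) (Ĝ : P'.D.hat.X.left ⟶ 𝓜.univ.D.hat.X.left),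
            P'.IsBaseChangeVia 𝓜.univ
                ((AlgPoints.baseChangeEquiv (algebraMap ℚ ℂ) 𝓜.M).symm (AlgPoints.map ιc (unif Z))).left G Ĝ ∧
            IsAdmissibleAt hδ r Z hZ P') ∧
        (∀ (P' : PolarizedAbelianSchemeWithLevel g N δ (specOver ℚ ℂ).left), IsAdmissibleAt hδ r Z hZ P' →
            AlgPoints.map ιc (unif Z)
              = AlgPoints.baseChangeEquiv (algebraMap ℚ ℂ) 𝓜.M (𝓜.classifyingMap (specOver ℚ ℂ) P')))
    -- a smooth complex variety over the piece and the pulled-back universal triple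
    (T : SchemeOver ℂ) (d : ℕ) [LocallyOfFiniteType T.hom] [IsSeparated T.hom] [SmoothOfRelativeDimension d T.hom] (ψ : T ⟶ Sc)
    -- analytifications of `T` and of the total space of the pulled-back abelian scheme
    (MT : Type) [TopologicalSpace MT] [ChartedSpace (Fin d → ℂ) MT] [IsManifold 𝓘(ℂ, Fin d → ℂ) ω MT]
    (φT : MT → ComplexPoints T) (hT : IsAnalytification (Fin d → ℂ) T d φT)
    (MA : Type) [TopologicalSpace MA] [ChartedSpace (Fin (d + g) → ℂ) MA] [IsManifold 𝓘(ℂ, Fin (d + g) → ℂ) ω MA]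
    (φA : MA → ComplexPoints (totalOver T
      (𝓜.univ.baseChange (ψ.left ≫ ιc.left ≫ pullback.fst 𝓜.M.hom (Spec.map (CommRingCat.ofHom (algebraMap ℚ ℂ))))).A))
    (_ : IsAnalytification (Fin (d + g) → ℂ) (totalOver T
      (𝓜.univ.baseChange (ψ.left ≫ ιc.left ≫ pullback.fst 𝓜.M.hom (Spec.map (CommRingCat.ofHom (algebraMap ℚ ℂ))))).A) (d + g) φA)
    -- an open of `T^an` with a holomorphic lift of `ψ^an` through `unif`
    (U : Set MT) (_ : IsOpen U) (s : MT → Matrix (Fin g) (Fin g) ℂ) (hs : ∀ t ∈ U, s t ∈ siegelUpperHalfSpace g)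
    (_ : ∀ i j, MDifferentiableOn 𝓘(ℂ, Fin d → ℂ) 𝓘(ℂ, ℂ) (fun t => s t i j) U)
    (_ : ∀ t ∈ U, unif (s t) = AlgPoints.map ψ (φT t)),
  letI P := 𝓜.univ.baseChange (ψ.left ≫ ιc.left ≫ pullback.fst 𝓜.M.hom (Spec.map (CommRingCat.ofHom (algebraMap ℚ ℂ))))
  ∃ (Φ : MT → ((Fin g ⊕ Fin g → ℝ) ≃L[ℝ] (Fin g → ℂ))) (ex : MT × (Fin g → ℂ) → MA),
    -- the period family is the tautological one
    (∀ t ∈ U, ∀ v : Fin g ⊕ Fin g → ℝ, Φ t v = siegelPeriodMap δ (s t) v) ∧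
    -- (C) the chart
    IsRelExpChartOn (Fin d → ℂ) (Fin (d + g) → ℂ) (basePoint hT P.A φA) U Φ ex ∧
    -- (G) the fibre maps are additive analytifications of the fibres, read in the total space
    (∀ t ∈ U, ∃ φt : ComplexTorus (Φ t) → (P.A.fibre (φT t).left).toAbelianVariety.Points ℂ,
      IsAnalytification (Fin g → ℂ) (P.A.fibre (φT t).left).toAbelianVariety.X g φt ∧
      (∀ x y, φt (x + y) = φt x * φt y) ∧
      ∀ z : Fin g → ℂ, (φA (ex (t, z))).left = P.A.fibrePointToLeft (φT t).left (φt (cover (Φ t) z))) ∧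
    -- (ADM) the fibre maps ARE admissible markings by `[J(s̃ t), r]`, for every principal representative `r` of `c`
    (∀ (u : finAdeleQˣ) (r : gspFinAdelic δ),
      (∀ v, Valued.v ((u : finAdeleQ) v) = 1) →
      (u : finAdeleQ) - ((c : ZMod N).val : ℕ) ∈ levelIdeal N →
      r ∈ principalLevelSubgroup δ 1 →
      IsMultiplier (typeFormOver δ finAdeleQ) (r : GL (Fin g ⊕ Fin g) finAdeleQ) u →
      ((r : GL (Fin g ⊕ Fin g) finAdeleQ) : Matrix (Fin g ⊕ Fin g) (Fin g ⊕ Fin g) finAdeleQ) =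
        Matrix.fromBlocks 1 0 0 ((u : finAdeleQ) • (1 : Matrix (Fin g) (Fin g) finAdeleQ)) →
      ∀ (t : MT) (ht : t ∈ U),
        ∃ (m : SiegelAdelicMarking ⟨jOfSiegel δ (s t), SiegelComplexRecordSystem.jOfSiegel_mem_C0pm hδ.1 (hs t ht)⟩ r
              (P.A.fibre (φT t).left).toAbelianVariety)
          (Θ : CartierDivisor (P.A.fibre (φT t).left).toAbelianVariety.X.left)
          (Λ : P.level.SymplecticLift (φT t).left Θ δ),
          -- the three conjuncts of ★ `IsAdmissibleAt`, read AT THE POINT `φT t` of the pulled-back triple `P`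
          Θ.IsAmple ∧ P.A.IsLambdaOfAt (φT t).left P.D P.pol.lam Θ ∧
          (∀ ⦃M : ℕ⦄, N ∣ M → M ≠ 0 → ∀ (x : Fin g ⊕ Fin g → ZMod M) (v : Fin g ⊕ Fin g → ℚ),
            AdelicCongr ((r⁻¹ : gspFinAdelic δ) : GL (Fin g ⊕ Fin g) finAdeleQ) 1 v (fun i => ((x i).val : ℚ) / M) →
              ((Λ.lift M (Multiplicative.ofAdd x)) : (P.A.fibre (φT t).left).toAbelianVariety.Points ℂ) = m.r v) ∧
          -- the marking IS the chart: trivial basis matrix, tautological complex coordinates, torus map = fibre map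
          m.γ = 1 ∧ (∀ v : Fin g ⊕ Fin g → ℝ, m.Ψ v = siegelPeriodMap δ (s t) v) ∧
          ∀ z : Fin g → ℂ, P.A.fibrePointToLeft (φT t).left (m.toFun (cover m.Ψ z)) = (φA (ex (t, z))).left)

end Literature.AlgebraicGeometry.ModuliOfAbelianVarieties

end
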